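import Summits.CriticalPhenomena.PercolationContinuityZ3.Theorems.PercNearOneGluingNoHeavyLowerTailAPLNonuniformPinned
import Summits.CriticalPhenomena.PercolationContinuityZ3.Theorems.PercNearOneGluingNoHeavyLowerTailAPLMergeKappa
import Literature.Probability.Percolation.TwoSetExchange
import Literature.Probability.Percolation.KozmaNitzanPinning
import HarnessLib

/-!
# `NoHeavyLowerTail` (stmt-CriticalPhenomena-4575) — proof of APL-P for all finite weighted graphs, the one-edge step: conditioning on an apex edge, endpoint identification, and ROW Π (a BHK 2006 instance)

Support file (prover prim-ineq-gen-8 gen 37; `--supports stmt-CriticalPhenomena-4575`; memo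
run/shared/lean/prim/prim-ineq-gen-8/FINDING-gen37-APL-PROOF.md §1–§2).  No definitions, no named facts, no sorries.

SETTING.  `μ = prodBernoulli w` on the pairs of a finite vertex type `V`; a finite GLUED APEX SET `S` (`S ~ x :⟺ ∃ s ∈ S, s ↔ x`, event
`⋃ s ∈ S, openConn s x`) and two targets `b, c`.  The four ISOLATION EVENTS of the glued instance `(S; b, c)`:
  `U_S = {¬S~b} ∩ {¬S~c} ∩ {b ↮ c}`, `A_S = {¬S~b} ∩ {¬S~c}`, `B_S = {¬S~b} ∩ {b ↮ c}`, `C_S = {¬S~c} ∩ {b ↮ c}`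
(for `S = {a}`: `μ(a|b|c)`, `μ(a ∤ bc)`, `μ(b ∤ ac)`, `μ(c ∤ ab)`).  Fix a pair `e = s(s,t)` with `s ∈ S`, `t ∉ S`.
* `reach_closed`, `setConn_insert_iff_diff`, `conn_bc_iff_diff` — combinatorics: the four events of `S ∪ {t}` do not depend on the
  coordinate `e`, and on `{e open}` the events of `S` and of `S ∪ {t}` coincide (`APL.setConn_union_iff`);
* `real_eq_pin_zero_add_pin_one` — conditioning on `e`: `μ_w(E) = (1 − w e)·μ_{w[e↦0]}(E) + (w e)·μ_{w[e↦1]}(E)` (Kozma–Nitzan pinning toolkit);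
* `pin_one_eq_pin_zero_insert_*` — ENDPOINT IDENTIFICATION: `μ_{w[e↦1]}(X_S) = μ_{w[e↦0]}(X_{S∪{t}})` for `X ∈ {U,A,B,C}`;
* `rowPi_b`, `rowPi_c`, **`rowPi_glued`** — ROW Π: with `X₀ = μ(X_S)`, `X₁ = μ(X_{S∪{t}})` (same weights),
  `U₀·((B₀−B₁)C₀ + (C₀−C₁)B₀) ≤ (U₀−U₁)·B₀C₀`, from two instances of van den Berg–Häggström–Kahn 2006 Thm 2.1 (sets),
  `Literature.Probability.Percolation.setTwoClusterExchange` with `S' = {b}`, `T = S ∪ {c}` (resp. `b ↔ c`): given `{b ↮ S ∪ {c}}`,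
  `Cov(1[t ∈ C_b], 1[S ~ c]) ≤ 0` (for `S = {a}` this is gen 33's `APL.merge_attach_mono`).
The induction and the theorems APL-P / APL(2/3) for all graphs are in `…APLProfileAll.lean`. [this work]
-/

noncomputable section

namespace Summit.CriticalPhenomena.PercolationContinuityZ3.Theorems

namespace APL

open MeasureTheory Set Literature.Probability.Percolation Literature.Probability.LatticeModels
  Literature.Probability.Percolation.TwoSetExchange
open Literature.Probability.Percolation.KNPreFKG (openConn_symm)
open scoped Classical

variable {V : Type*}

/-! ### Combinatorics of one edge -/

/-- A property that holds at `u` and is preserved along open edges holds on the whole open cluster of `u`. [folklore] -/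
theorem reach_closed {ω : BondConfig V} {P : V → Prop} (hP : ∀ x y, (openGraph ω).Adj x y → P x → P y)
    {u v : V} (h : (openGraph ω).Reachable u v) (hu : P u) : P v := by
  obtain ⟨p⟩ := h
  induction p with
  | nil => exact hu
  | cons hadj _ ih => exact ih (hP _ _ hadj hu)

/-- Removing edges can only destroy connections. [folklore] -/
theorem openConn_anti {ω ω' : BondConfig V} (h : ω' ⊆ ω) {u v : V} (huv : ω' ∈ (openConn u v : Set (BondConfig V))) :
    ω ∈ (openConn u v : Set (BondConfig V)) := by
  refine SimpleGraph.Reachable.mono ?_ huv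
  intro x y hxy
  rw [openGraph_adj] at hxy ⊢
  exact ⟨h hxy.1, hxy.2⟩

/-- **The glued set `insert t S` with `s ∈ S` reaches `x` in `ω` iff it does in `ω ∖ {s(s,t)}`** (a walk that uses the edge `s–t`
can be restarted at its last visit to `{s,t} ⊆ insert t S`). [this work] -/
theorem setConn_insert_iff_diff (S : Set V) {s : V} (hs : s ∈ S) (t x : V) (ω : BondConfig V) :
    (∃ u ∈ insert t S, ω ∈ (openConn u x : Set (BondConfig V))) ↔
      ∃ u ∈ insert t S, (ω \ {s(s, t)}) ∈ (openConn u x : Set (BondConfig V)) := by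
  constructor
  · rintro ⟨u, hu, hux⟩
    -- closure argument
    have key : ∀ y, (openGraph ω).Reachable u y → ∃ u' ∈ insert t S, (ω \ {s(s, t)}) ∈ (openConn u' y : Set (BondConfig V)) := by
      intro y huy
      refine reach_closed (P := fun y => ∃ u' ∈ insert t S, (ω \ {s(s, t)}) ∈ (openConn u' y : Set (BondConfig V)))
        ?_ huy ⟨u, hu, SimpleGraph.Reachable.refl u⟩
      intro y y' hyy' ⟨u', hu', hu'y⟩
      rw [openGraph_adj] at hyy'
      by_cases he : s(y, y') = s(s, t)
      · -- the new vertex is `s` or `t`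
        have hy' : y' = s ∨ y' = t := by
          have := Sym2.mem_iff.1 (he ▸ Sym2.mem_mk_right y y' : y' ∈ s(s, t))
          exact this
        rcases hy' with rfl | rfl
        · exact ⟨y', mem_insert_of_mem _ hs, SimpleGraph.Reachable.refl _⟩
        · exact ⟨y', mem_insert _ _, SimpleGraph.Reachable.refl _⟩
      · refine ⟨u', hu', SimpleGraph.Reachable.trans hu'y (SimpleGraph.Adj.reachable ?_)⟩
        rw [openGraph_adj]
        exact ⟨⟨hyy'.1, he⟩, hyy'.2⟩
    exact key x hux
  · rintro ⟨u, hu, hux⟩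
    exact ⟨u, hu, openConn_anti (fun _ hx => hx.1) hux⟩

/-- **If `insert t S` (with `s ∈ S`) does not reach `b` off the edge `s–t`, then `b ↔ c` does not depend on that edge.** [this work] -/
theorem conn_bc_iff_diff (S : Set V) {s : V} (hs : s ∈ S) (t b c : V) (ω : BondConfig V)
    (hb : ¬ ∃ u ∈ insert t S, (ω \ {s(s, t)}) ∈ (openConn u b : Set (BondConfig V))) :
    ω ∈ (openConn b c : Set (BondConfig V)) ↔ (ω \ {s(s, t)}) ∈ (openConn b c : Set (BondConfig V)) := by
  constructor
  · intro hbc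
    refine reach_closed (P := fun y => (ω \ {s(s, t)}) ∈ (openConn b y : Set (BondConfig V))) ?_ hbc
      (SimpleGraph.Reachable.refl b)
    intro y y' hyy' hby
    rw [openGraph_adj] at hyy'
    by_cases he : s(y, y') = s(s, t)
    · exfalso
      have hy : y = s ∨ y = t := Sym2.mem_iff.1 (he ▸ Sym2.mem_mk_left y y' : y ∈ s(s, t))
      apply hb
      have hyb : (ω \ {s(s, t)}) ∈ (openConn y b : Set (BondConfig V)) := SimpleGraph.Reachable.symm hby
      rcases hy with rfl | rfl
      · exact ⟨y, mem_insert_of_mem _ hs, hyb⟩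
      · exact ⟨y, mem_insert _ _, hyb⟩
    · refine SimpleGraph.Reachable.trans hby (SimpleGraph.Adj.reachable ?_)
      rw [openGraph_adj]
      exact ⟨⟨hyy'.1, he⟩, hyy'.2⟩
  · exact openConn_anti (fun _ hx => hx.1)

/-! ### The four events of `insert t S` do not depend on the edge `s–t` -/

section Events

variable (S : Set V) {s : V} (hs : s ∈ S) (t b c : V)
include hs

/-- `U_{S∪t}` is determined by the other coordinates. [this work] -/
theorem mem_U_insert_iff_diff (ω : BondConfig V) :
    ω ∈ ((⋃ u ∈ insert t S, (openConn u b : Set (BondConfig V)))ᶜ ∩ (⋃ u ∈ insert t S, (openConn u c : Set (BondConfig V)))ᶜ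
        ∩ (openConn b c : Set (BondConfig V))ᶜ) ↔
      (ω \ {s(s, t)}) ∈ ((⋃ u ∈ insert t S, (openConn u b : Set (BondConfig V)))ᶜ
        ∩ (⋃ u ∈ insert t S, (openConn u c : Set (BondConfig V)))ᶜ ∩ (openConn b c : Set (BondConfig V))ᶜ) := by
  simp only [mem_inter_iff, mem_compl_iff, mem_iUnion, exists_prop]
  rw [setConn_insert_iff_diff S hs t b ω, setConn_insert_iff_diff S hs t c ω]
  constructor
  · rintro ⟨⟨h1, h2⟩, h3⟩
    exact ⟨⟨h1, h2⟩, fun h => h3 ((conn_bc_iff_diff S hs t b c ω h1).2 h)⟩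
  · rintro ⟨⟨h1, h2⟩, h3⟩
    exact ⟨⟨h1, h2⟩, fun h => h3 ((conn_bc_iff_diff S hs t b c ω h1).1 h)⟩

/-- `A_{S∪t}` is determined by the other coordinates. [this work] -/
theorem mem_A_insert_iff_diff (ω : BondConfig V) :
    ω ∈ ((⋃ u ∈ insert t S, (openConn u b : Set (BondConfig V)))ᶜ ∩ (⋃ u ∈ insert t S, (openConn u c : Set (BondConfig V)))ᶜ) ↔
      (ω \ {s(s, t)}) ∈ ((⋃ u ∈ insert t S, (openConn u b : Set (BondConfig V)))ᶜ
        ∩ (⋃ u ∈ insert t S, (openConn u c : Set (BondConfig V)))ᶜ) := by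
  simp only [mem_inter_iff, mem_compl_iff, mem_iUnion, exists_prop]
  rw [setConn_insert_iff_diff S hs t b ω, setConn_insert_iff_diff S hs t c ω]

/-- `B_{S∪t}` is determined by the other coordinates. [this work] -/
theorem mem_B_insert_iff_diff (ω : BondConfig V) :
    ω ∈ ((⋃ u ∈ insert t S, (openConn u b : Set (BondConfig V)))ᶜ ∩ (openConn b c : Set (BondConfig V))ᶜ) ↔
      (ω \ {s(s, t)}) ∈ ((⋃ u ∈ insert t S, (openConn u b : Set (BondConfig V)))ᶜ ∩ (openConn b c : Set (BondConfig V))ᶜ) := by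
  simp only [mem_inter_iff, mem_compl_iff, mem_iUnion, exists_prop]
  rw [setConn_insert_iff_diff S hs t b ω]
  constructor
  · rintro ⟨h1, h3⟩
    exact ⟨h1, fun h => h3 ((conn_bc_iff_diff S hs t b c ω h1).2 h)⟩
  · rintro ⟨h1, h3⟩
    exact ⟨h1, fun h => h3 ((conn_bc_iff_diff S hs t b c ω h1).1 h)⟩

/-- `C_{S∪t}` is determined by the other coordinates. [this work] -/
theorem mem_C_insert_iff_diff (ω : BondConfig V) :
    ω ∈ ((⋃ u ∈ insert t S, (openConn u c : Set (BondConfig V)))ᶜ ∩ (openConn b c : Set (BondConfig V))ᶜ) ↔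
      (ω \ {s(s, t)}) ∈ ((⋃ u ∈ insert t S, (openConn u c : Set (BondConfig V)))ᶜ ∩ (openConn b c : Set (BondConfig V))ᶜ) := by
  simp only [mem_inter_iff, mem_compl_iff, mem_iUnion, exists_prop]
  rw [setConn_insert_iff_diff S hs t c ω]
  constructor
  · rintro ⟨h1, h3⟩
    refine ⟨h1, fun h => h3 ?_⟩
    rw [openConn_symm] at h ⊢
    exact (conn_bc_iff_diff S hs t c b ω h1).2 h
  · rintro ⟨h1, h3⟩
    refine ⟨h1, fun h => h3 ?_⟩
    rw [openConn_symm] at h ⊢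
    exact (conn_bc_iff_diff S hs t c b ω h1).1 h

end Events

/-- An event `E` with `ω ∈ E ↔ ω ∖ {e} ∈ E` is determined by the coordinates other than `e`. [folklore] -/
theorem determinedBy_compl_singleton_of {E : Set (BondConfig V)} {e : Sym2 V} (h : ∀ ω, ω ∈ E ↔ ω \ {e} ∈ E) :
    DeterminedBy E ({e}ᶜ : Set (Sym2 V)) := by
  rw [determinedBy_iff]
  intro ω ω' hF
  rw [h ω, h ω', show ω \ {e} = ω ∩ {e}ᶜ from rfl, show ω' \ {e} = ω' ∩ {e}ᶜ from rfl, hF]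

/-! ### Conditioning on one edge -/

section Pin

variable [Fintype V] (w : Sym2 V → unitInterval) (e : Sym2 V)

omit [Fintype V] in
/-- The cylinder "`e` open". [folklore] -/
theorem localCylinder_singleton_self : localCylinder ({e} : Set (Sym2 V)) {e} = {ω : BondConfig V | e ∈ ω} := by
  ext ω; simp [localCylinder]

omit [Fintype V] in
/-- The cylinder "`e` closed". [folklore] -/
theorem localCylinder_singleton_empty : localCylinder ({e} : Set (Sym2 V)) (∅ : Set (Sym2 V)) = {ω : BondConfig V | e ∉ ω} := by
  ext ω; simp [localCylinder]

/-- **Conditioning on the state of one pair**: `μ_w(E) = (1 − w e)·μ_{w[e↦0]}(E) + (w e)·μ_{w[e↦1]}(E)`, where `w[e↦0] = pinW w {e} ∅`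
and `w[e↦1] = pinW w {e} {e}`. [folklore; Kozma–Nitzan pinning toolkit] -/
theorem real_eq_pin_zero_add_pin_one (E : Set (BondConfig V)) :
    (prodBernoulli w).real E = (1 - (w e : ℝ)) * (prodBernoulli (pinW w ({e} : Set (Sym2 V)) (∅ : Set (Sym2 V)))).real E
      + (w e : ℝ) * (prodBernoulli (pinW w ({e} : Set (Sym2 V)) {e})).real E := by
  have hE : MeasurableSet E := MeasurableSet.of_discrete
  have h1 := prodBernoulli_real_inter_localCylinder w ({e} : Finset (Sym2 V)) ({e} : Set (Sym2 V)) hE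
  have h0 := prodBernoulli_real_inter_localCylinder w ({e} : Finset (Sym2 V)) (∅ : Set (Sym2 V)) hE
  rw [Finset.coe_singleton] at h1 h0
  rw [ClusterCovTransfer.real_eq_inter_add_inter_compl w E {ω : BondConfig V | e ∈ ω}]
  have hc : ({ω : BondConfig V | e ∈ ω})ᶜ = {ω : BondConfig V | e ∉ ω} := by ext ω; simp
  rw [hc, ← localCylinder_singleton_self e, ← localCylinder_singleton_empty e, h1, h0, localCylinder_singleton_self,
    localCylinder_singleton_empty, prodBernoulli_real_setOf_mem, prodBernoulli_real_setOf_notMem]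
  ring

omit [Fintype V] in
/-- Under `w[e↦1]` the pair `e` is a.s. open. [folklore] -/
theorem ae_mem_pin_one : ∀ᵐ ω ∂(prodBernoulli (pinW w ({e} : Set (Sym2 V)) {e})), e ∈ ω :=
  prodBernoulli_ae_mem_of_eq_one _ (pinW_apply_of_mem_of_mem w (mem_singleton e) (mem_singleton e))

/-- An event determined by the other coordinates has the same probability under `w[e↦1]` and `w[e↦0]`. [folklore] -/
theorem pin_one_eq_pin_zero_of_determinedBy {E : Set (BondConfig V)} (hE : DeterminedBy E ({e}ᶜ : Set (Sym2 V))) :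
    (prodBernoulli (pinW w ({e} : Set (Sym2 V)) {e})).real E = (prodBernoulli (pinW w ({e} : Set (Sym2 V)) (∅ : Set (Sym2 V)))).real E :=
  prodBernoulli_real_eq_of_determinedBy _ _ (fun i hi => by
    rw [pinW_apply_of_not_mem w _ hi, pinW_apply_of_not_mem w _ hi]) hE MeasurableSet.of_discrete

end Pin

/-! ### Endpoint identification: `μ_{w[e↦1]}(X_S) = μ_{w[e↦0]}(X_{S ∪ {t}})` -/

section Endpoint

variable [Fintype V] (w : Sym2 V → unitInterval) (S : Finset V) {s t : V} (hs : s ∈ S) (ht : t ∉ S) (b c : V)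
include hs ht

omit [Fintype V] in
/-- On `{e open}` the glued sets `S` and `insert t S` reach the same vertices. [folklore] -/
theorem setConn_iff_insert_of_mem {ω : BondConfig V} (he : s(s, t) ∈ ω) (x : V) :
    (∃ u ∈ (↑S : Set V), ω ∈ (openConn u x : Set (BondConfig V))) ↔
      ∃ u ∈ insert t (↑S : Set V), ω ∈ (openConn u x : Set (BondConfig V)) := by
  rw [insert_eq, union_comm]
  exact setConn_union_iff (S := (↑S : Set V)) (R := {t}) fun t' ht' => by
    rw [mem_singleton_iff] at ht'
    subst ht'
    exact ⟨fun h => ht (Finset.mem_coe.1 h), s, Finset.mem_coe.2 hs, he⟩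

/-- Endpoint identification for `U`. [this work] -/
theorem pin_one_U :
    (prodBernoulli (pinW w ({s(s, t)} : Set (Sym2 V)) {s(s, t)})).real
        ((⋃ u ∈ (↑S : Set V), (openConn u b : Set (BondConfig V)))ᶜ ∩ (⋃ u ∈ (↑S : Set V), (openConn u c : Set (BondConfig V)))ᶜ
          ∩ (openConn b c : Set (BondConfig V))ᶜ) =
      (prodBernoulli (pinW w ({s(s, t)} : Set (Sym2 V)) (∅ : Set (Sym2 V)))).real
        ((⋃ u ∈ insert t (↑S : Set V), (openConn u b : Set (BondConfig V)))ᶜ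
          ∩ (⋃ u ∈ insert t (↑S : Set V), (openConn u c : Set (BondConfig V)))ᶜ ∩ (openConn b c : Set (BondConfig V))ᶜ) := by
  rw [← pin_one_eq_pin_zero_of_determinedBy w s(s, t)
    (determinedBy_compl_singleton_of (mem_U_insert_iff_diff (↑S : Set V) (Finset.mem_coe.2 hs) t b c))]
  refine measureReal_congr ?_
  filter_upwards [ae_mem_pin_one w s(s, t)] with ω hω
  apply propext
  show ω ∈ (_ : Set (BondConfig V)) ↔ ω ∈ (_ : Set (BondConfig V))
  simp only [mem_setOf_eq, mem_inter_iff, mem_compl_iff, mem_iUnion, exists_prop]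
  rw [setConn_iff_insert_of_mem S hs ht hω b, setConn_iff_insert_of_mem S hs ht hω c]

/-- Endpoint identification for `A`. [this work] -/
theorem pin_one_A :
    (prodBernoulli (pinW w ({s(s, t)} : Set (Sym2 V)) {s(s, t)})).real
        ((⋃ u ∈ (↑S : Set V), (openConn u b : Set (BondConfig V)))ᶜ ∩ (⋃ u ∈ (↑S : Set V), (openConn u c : Set (BondConfig V)))ᶜ) =
      (prodBernoulli (pinW w ({s(s, t)} : Set (Sym2 V)) (∅ : Set (Sym2 V)))).real
        ((⋃ u ∈ insert t (↑S : Set V), (openConn u b : Set (BondConfig V)))ᶜ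
          ∩ (⋃ u ∈ insert t (↑S : Set V), (openConn u c : Set (BondConfig V)))ᶜ) := by
  rw [← pin_one_eq_pin_zero_of_determinedBy w s(s, t)
    (determinedBy_compl_singleton_of (mem_A_insert_iff_diff (↑S : Set V) (Finset.mem_coe.2 hs) t b c))]
  refine measureReal_congr ?_
  filter_upwards [ae_mem_pin_one w s(s, t)] with ω hω
  apply propext
  show ω ∈ (_ : Set (BondConfig V)) ↔ ω ∈ (_ : Set (BondConfig V))
  simp only [mem_setOf_eq, mem_compl_iff, mem_iUnion, exists_prop]
  rw [setConn_iff_insert_of_mem S hs ht hω b, setConn_iff_insert_of_mem S hs ht hω c]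

/-- Endpoint identification for `B`. [this work] -/
theorem pin_one_B :
    (prodBernoulli (pinW w ({s(s, t)} : Set (Sym2 V)) {s(s, t)})).real
        ((⋃ u ∈ (↑S : Set V), (openConn u b : Set (BondConfig V)))ᶜ ∩ (openConn b c : Set (BondConfig V))ᶜ) =
      (prodBernoulli (pinW w ({s(s, t)} : Set (Sym2 V)) (∅ : Set (Sym2 V)))).real
        ((⋃ u ∈ insert t (↑S : Set V), (openConn u b : Set (BondConfig V)))ᶜ ∩ (openConn b c : Set (BondConfig V))ᶜ) := by
  rw [← pin_one_eq_pin_zero_of_determinedBy w s(s, t)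
    (determinedBy_compl_singleton_of (mem_B_insert_iff_diff (↑S : Set V) (Finset.mem_coe.2 hs) t b c))]
  refine measureReal_congr ?_
  filter_upwards [ae_mem_pin_one w s(s, t)] with ω hω
  apply propext
  show ω ∈ (_ : Set (BondConfig V)) ↔ ω ∈ (_ : Set (BondConfig V))
  simp only [mem_setOf_eq, mem_compl_iff, mem_iUnion, exists_prop]
  rw [setConn_iff_insert_of_mem S hs ht hω b]

/-- Endpoint identification for `C`. [this work] -/
theorem pin_one_C :
    (prodBernoulli (pinW w ({s(s, t)} : Set (Sym2 V)) {s(s, t)})).real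
        ((⋃ u ∈ (↑S : Set V), (openConn u c : Set (BondConfig V)))ᶜ ∩ (openConn b c : Set (BondConfig V))ᶜ) =
      (prodBernoulli (pinW w ({s(s, t)} : Set (Sym2 V)) (∅ : Set (Sym2 V)))).real
        ((⋃ u ∈ insert t (↑S : Set V), (openConn u c : Set (BondConfig V)))ᶜ ∩ (openConn b c : Set (BondConfig V))ᶜ) := by
  rw [← pin_one_eq_pin_zero_of_determinedBy w s(s, t)
    (determinedBy_compl_singleton_of (mem_C_insert_iff_diff (↑S : Set V) (Finset.mem_coe.2 hs) t b c))]
  refine measureReal_congr ?_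
  filter_upwards [ae_mem_pin_one w s(s, t)] with ω hω
  apply propext
  show ω ∈ (_ : Set (BondConfig V)) ↔ ω ∈ (_ : Set (BondConfig V))
  simp only [mem_setOf_eq, mem_compl_iff, mem_iUnion, exists_prop]
  rw [setConn_iff_insert_of_mem S hs ht hω c]

end Endpoint

/-! ### ROW Π from van den Berg–Häggström–Kahn -/

section RowPi

variable [Fintype V] (w : Sym2 V → unitInterval) (S : Finset V) (t b c : V)

omit [Fintype V] in
/-- The BHK separation event `{b ↮ S ∪ {c}}` is the event `B_S = {¬S~b} ∩ {b ↮ c}`. [folklore] -/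
theorem bhkQ_eq :
    {ω : BondConfig V | ∀ s' ∈ ({b} : Set V), ∀ t' ∈ (↑S ∪ {c} : Set V), ¬ (openGraph ω).Reachable s' t'} =
      ((⋃ u ∈ (↑S : Set V), (openConn u b : Set (BondConfig V)))ᶜ ∩ (openConn b c : Set (BondConfig V))ᶜ) := by
  ext ω
  simp only [mem_setOf_eq, mem_singleton_iff, forall_eq, mem_union, mem_inter_iff, mem_compl_iff, mem_iUnion, exists_prop,
    not_exists, not_and]
  constructor
  · intro h
    refine ⟨fun u hu hub => h u (Or.inl hu) ?_, fun hbc => h c (Or.inr rfl) hbc⟩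
    exact SimpleGraph.Reachable.symm hub
  · rintro ⟨h1, h2⟩ t' (ht' | ht')
    · exact fun h => h1 t' ht' (SimpleGraph.Reachable.symm h)
    · subst ht'; exact h2

/-- **ROW Π_b** (BHK 2006 Thm 2.1, `S' = {b}`, `T = S ∪ {c}`, `f = 1[b ↔ t]`, `g = 1[S ~ c]`): with `Q = B_S`, `G = {S ~ c}`,
`μ(Q)·μ(Q ∩ {b↔t} ∩ G) ≤ μ(Q ∩ {b↔t})·μ(Q ∩ G)`. [cite: VandenbergHaggstromKahn2005, Thm. 2.1 (p. 9) — instance, derived here] -/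
theorem rowPi_b_cov :
    (prodBernoulli w).real ((⋃ u ∈ (↑S : Set V), (openConn u b : Set (BondConfig V)))ᶜ ∩ (openConn b c : Set (BondConfig V))ᶜ) *
      (prodBernoulli w).real (((⋃ u ∈ (↑S : Set V), (openConn u b : Set (BondConfig V)))ᶜ ∩ (openConn b c : Set (BondConfig V))ᶜ) ∩
        ((openConn b t : Set (BondConfig V)) ∩ ⋃ u ∈ (↑S : Set V), (openConn u c : Set (BondConfig V)))) ≤
    (prodBernoulli w).real (((⋃ u ∈ (↑S : Set V), (openConn u b : Set (BondConfig V)))ᶜ ∩ (openConn b c : Set (BondConfig V))ᶜ) ∩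
        (openConn b t : Set (BondConfig V))) *
      (prodBernoulli w).real (((⋃ u ∈ (↑S : Set V), (openConn u b : Set (BondConfig V)))ᶜ ∩ (openConn b c : Set (BondConfig V))ᶜ) ∩
        ⋃ u ∈ (↑S : Set V), (openConn u c : Set (BondConfig V))) := by
  have hb : b ∈ ({b} : Set V) := mem_singleton b
  have key := setTwoClusterExchange w ({b} : Set V) (↑S ∪ {c} : Set V)
    (A₁ := (univ : Set (BondConfig V))) (A₂ := (openConn b t : Set (BondConfig V)))
    (B₁ := (univ : Set (BondConfig V))) (B₂ := ⋃ u ∈ (↑S : Set V), (openConn u c : Set (BondConfig V)))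
    (fun _ _ _ _ _ => mem_univ _)
    (fun _ _ hs' ht' h => typePlus_openConn_of_mem ({b} : Set V) (↑S ∪ {c} : Set V) hb t hs' ht' h)
    (fun _ _ _ _ _ => mem_univ _)
    (fun ω ω' hs' ht' h => by
      simp only [mem_iUnion, exists_prop] at h ⊢
      obtain ⟨u, hu, huc⟩ := h
      exact ⟨u, hu, typeMinus_openConn_of_mem ({b} : Set V) (↑S ∪ {c} : Set V) (Or.inl hu) c hs' ht' huc⟩)
  rw [bhkQ_eq] at key
  simpa only [univ_inter, inter_univ] using key

end RowPi

end APL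

end Summit.CriticalPhenomena.PercolationContinuityZ3.Theorems

end
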